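import Summits.ABC.IUTFork.Cor312TeamAChain
import Summits.ABC.IUTFork.Cor312StepPreXReadings
import Summits.ABC.IUTFork.ForkInputStrip
import Summits.ABC.IUTFork.Thm311LinkCompat
import Summits.ABC.IUTFork.Cor312GapGlobalCountermodel
import HarnessLib

/-!
# [IUTchIII] Cor. 3.12 — TEAM A census under ONE honest reading of all thirty-six observations: eight hypotheses and THE GAP

Record-only file (D-0012; one bookkeeping `def` = the reading, otherwise proofs) of the abc-iut cell (D-0067 discharge wave 4, seat abc-iut-w4-d021; bears on the
11:30Z TEAM A RESULT line and the 12:30Z block, plan/ADJUDICATION-SPEC.md §2 (G1)/(U)). TAKES NO SIDE on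
[IUTchIII] Cor. 3.12. S. Mochizuki, *Inter-universal Teichmüller theory III*, kurims manuscript (May 2020), Cor. 3.12,
proof pp. 174–186, Step (xi-f) p. 184 l. 19–29 [cite: Mochizuki2012, III Cor 3.12 pp.174–186]; claim key DISPUTED.

WHAT THIS ADDS. The landed census `Cor312Proof.teamA_statement_end_to_end` (Cor312TeamAChain.lean p412737) proves the
printed `Statement` from c312-2's twenty-node chain with ≈ 40 hypotheses: the pre-(x) observation readings GRANTED, the
Step (x)/(xi-a)–(xi-e) observations WIRED to row files' honest readings by implication-hypotheses (`hO1…hO4`, `hOxia`,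
`hOb1–3`, `hIPLrev`, `hOc1–2`, `AgreesXIde`), the tail observations granted, THE GAP `hgap`, and the reading funnel
`hread` (per-packet R0). Every wire is dischargeable by a landed row file — but only once a CONCRETE reading
`O : Obs → Prop` is fixed. This file fixes it: `Cor312Proof.honestReading P C D L A` assigns to EVERY observation of
the printed proof its honest kernel content of record —
* the fifteen narrative pre-(x) observations ↦ `True` and Step (i)'s `valueGroupMapsPilots` ↦ `Nonempty (LinkGluing P)`
  (row A-5, `Cor312StepPreXReadings.OPreX`, no-inflation rule);
* Step (x) ↦ `StepX.KummerDetach / LogvolCoarse / LogvolLogLink / TensorMultZ` (row A-1, `OStepX`);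
* (xi-a)–(xi-c) ↦ `StepXI.LinkAsGluing / OutputIPLSHE (L IPL) (L SHE) / ValueGroupFullPoly / OnlyQualitative / DisplayXIc /
  HullComparable` (row A-2);
* (xi-d)/(xi-e) ↦ `DisplayXIdReal / ComparableObjectsReal / DegreesAsLogVolumesReal / OneColumnLogKummerReal /
  SheMeansFixedValueReal / DisplayXIeReal` (row A-3, `realReadingXIde`);
* (xi-f) `constitutesConstruction` ↦ **`A.GapGlobal`** — the GapA OF RECORD, LEVEL 0 (skel XXV; GAP-LEDGER G-c312-9-1):
  soundness of the multiradial algorithm at the link-identified input prime-strip, for a strip-algorithm presentation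
  `A` of the setting;
* (xi-g) `twoEquivalentWays` ↦ `A.out A.qIn = P.possibleImages` (the two ways to compute: by the link + (IPL) the
  q-strip's output possibilities ARE the possible images — `StripAlgorithm.out_qIn`, a theorem);
* (xi-h) `noNthPower` ↦ the landed `nthPower_not_formal` statement; (xii) `globalFrobenioidsNeeded` ↦ `True` (terminal
  narrative node, Rmk. 3.6.2 (i); `Step.concl_unique`: never invoked).
Under this reading ALL TWENTY NODES HOLD in the kernel (`honest_chain`) from: Team B's four Step (x) real
discharges (`hIndAdm`, `hIndVol`, `hMono`, `hKumA`), the strip-isomorphism nonemptiness `hNE` (Def. 3.8 (ii)'s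
presupposition, L6-t2 real instances), `ThetaFinite`, `|log(q)| > 0`, and ONE implication
`hgap : P.DisplayXIeReal → P.SheMeansFixedValueReal → A.GapGlobal` = the (xi-f) inference between TYPED readings; and
since both antecedents are theorems at any setting with `ThetaFinite ∧ AbsLogQPos` (row A-3), that slot IS `A.GapGlobal`
(`gapSlot_iff_gapGlobal`). END-TO-END (`teamA_statement_honest`): **eight named hypotheses**
{`BridgeHyps`, `hIndAdm`, `hIndVol`, `hMono`, `hKumA`, `hNE`, `AbsLogQPos`, `A.GapGlobal`} (+ `∀ c, L c`: the loci = the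
frozen definitions / FACT-LIST facts are in force) ⊢ `P.Statement`, every observation of the printed proof carrying
its honest typed content; `teamA_statement_honest_of_partII` / `_of_thm311` take the
Kummer-(a) input from the typed Theorem 3.11 (ii) BY NAME (column `C := S'.col n`). This is the (G1) sentence «every inference other than (xi-f) is kernel-discharged over the
frozen definitions» as ONE theorem whose hypothesis list a referee can read in eight lines. And (G3) FOR THIS
EXACT LIST: `honestCensus_premises_not_imp_gap` — at Team A's gap witness all eight non-gap hypotheses (with typed
Thm 3.11 IN FULL for the Kummer-(a) slot) hold while `GapGlobal` fails for every strip algorithm (uses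
`gapData_logvolInvariant`: the witness's two-valued log-volume is invariant under every `ℚ`-linear packet
automorphism); `hNE_satisfiable` — the strip-isomorphism slot is fillable at every setting from its own signature.

HONEST FRAMING: composition of LANDED theorems only (rows A-1…A-5, c312-2 chain, c312-7 verbatim bridge, skel XXV); no
new definition of mathematical content (the reading is a bookkeeping `def` assembling the row files' `Prop`s); nothing
here claims `A.GapGlobal` holds for any setting — it is THE GAP, kernel-equivalent to the Corollary's inequality at the
frozen interface (`InputStrip.gapGlobal_iff_statement`), non-derivable from typed Thm 3.11 + BridgeHyps
(`InputStrip.thm311_bridgeHyps_not_imp_gapGlobal`). typed ≠ proved; no side taken.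
-/

namespace Summit.ABC

namespace IUTFork

namespace Cor312Proof

open Locus Obs Thm311 Cor312 Cor312Vol StepXI Literature.IUT.LogThetaLattice

variable {T : ThetaIndex} {S : Situation T} (P : Cor312.Setting S)

/-- **The team's honest reading of the thirty-six observations of the printed proof** (one `Prop` per observation,
each the reading of record of rows A-1…A-5 — see the module docstring for the table; (xi-f) ↦ the GapA of record
`A.GapGlobal`, (xi-g) ↦ `A.out A.qIn = P.possibleImages`). Bookkeeping `def`; asserts nothing.
[claim: Mochizuki2012, status: disputed] -/
@[claim "Mochizuki2012" "disputed"] def honestReading (C : Column S.L) (D : ThetaLinkStrips P.LogLink P.Strip) (L : Locus → Prop)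
    (A : InputStrip.StripAlgorithm P) : Obs → Prop
  -- opening paragraph and Steps (i)–(ix): narrative at this typing level (row A-5), except Step (i)'s gluing datum
  | .restrictToStrips => True
  | .linkSplits => True
  | .valueGroupMapsPilots => Nonempty (LinkGluing P)
  | .unitsSubjectInd12 => True
  | .cyclotomesInsulated => True
  | .singleLinkNecessary => True
  | .verticalShiftSolved => True
  | .unitsRelatedContainers => True
  | .frobeniusLikeRelatedToCoric => True
  | .logKummerViaGaloisEvaluation => True
  | .conjSyncLogLinkCompatible => True
  | .cycRigidityApproaches => True
  | .symmetriesSeparate => True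
  | .symmetriesMultiradial => True
  | .conjugacyIndetResolved => True
  | .fmodTranslation => True
  -- Step (x) (row A-1)
  | .kummerDetachmentInd123 => StepX.KummerDetach P
  | .logvolInvariantInequality => StepX.LogvolCoarse P
  | .logvolLogLinkCompatible => StepX.LogvolLogLink P C
  | .tensorIdentifiesMultZ => StepX.TensorMultZ P
  -- Steps (xi-a)–(xi-c) (row A-2)
  | .linkAsGluing => LinkAsGluing P D (Nonempty (LinkGluing P))
  | .outputSatisfiesIPLSHE => OutputIPLSHE (L .IPL) (L .SHE)
  | .valueGroupLinkFullPolyIso => ValueGroupFullPoly P D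
  | .onlyQualitative => OnlyQualitative
  | .displayXIc => DisplayXIc P D (L .IPL) (L .SHE)
  | .hullGivesVectorBundles => HullComparable P
  -- Steps (xi-d)/(xi-e) (row A-3)
  | .displayXId => P.DisplayXIdReal
  | .comparableObjects => P.ComparableObjectsReal
  | .degreesAsLogVolumes => P.DegreesAsLogVolumesReal
  | .oneColumnLogKummerRectifies => P.OneColumnLogKummerReal
  | .sheMeansFixedValue => P.SheMeansFixedValueReal
  | .displayXIe => P.DisplayXIeReal
  -- the tail (row A-4): THE GAP at (xi-f), the strip-algorithm identity at (xi-g), (xi-h), (xii)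
  | .constitutesConstruction => A.GapGlobal
  | .twoEquivalentWays => A.out A.qIn = P.possibleImages
  | .noNthPower => ∃ V : Volumes, V.Cor312 ∧ V.negLogTheta = ((-1 : ℝ) : WithTop ℝ) ∧ ¬ (V.negAbsLogq ≤ 2 * (-1))
  | .globalFrobenioidsNeeded => True

variable {P}

/-- The honest reading agrees with row A-3's real readings of (xi-d)/(xi-e) (by construction). [folklore] -/
theorem agreesXIde_honestReading (C : Column S.L) (D : ThetaLinkStrips P.LogLink P.Strip) (L : Locus → Prop)
    (A : InputStrip.StripAlgorithm P) : P.AgreesXIde (honestReading P C D L A) :=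
  ⟨Iff.rfl, Iff.rfl, Iff.rfl, Iff.rfl, Iff.rfl, Iff.rfl⟩

/-- **ALL TWENTY NODES HOLD under the honest reading** ([IUTchIII] Cor. 3.12 proof, opening paragraph + Steps
(i)–(xii), pp. 174–186), from: Team B's four Step (x) real discharges, the strip-isomorphism nonemptiness, `ThetaFinite`,
`|log(q)| > 0`, and the ONE (xi-f) implication between typed readings
`hgap : DisplayXIeReal → SheMeansFixedValueReal → A.GapGlobal`. Every wire of `teamA_chain` is the identity here; the
pre-(x) slots are `trivial` / `linkGluing_nonempty`; (xi-g) is `StripAlgorithm.out_qIn`; (xi-h) is `nthPower_not_formal`.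
[claim: Mochizuki2012, status: disputed] -/
theorem honest_chain (C : Column S.L) (D : ThetaLinkStrips P.LogLink P.Strip) (L : Locus → Prop)
    (A : InputStrip.StripAlgorithm P)
    (hIndAdm : ∀ Φ ∈ S.L.Ind1Family ∪ S.L.Ind2Family, ∀ (j : T.Label) (vQ : T.VQ)
      (X : Set (S.L.Packet j vQ)), (S.D P.n).Adm j vQ X ↔ (S.D P.n).Adm j vQ (Φ j vQ '' X))
    (hIndVol : (S.D P.n).LogvolInvariant)
    (hMono : ∀ (j : T.Label) (vQ : T.VQ) (X Y : Set (S.L.Packet j vQ)),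
      (S.D P.n).Adm j vQ X → (S.D P.n).Adm j vQ Y → X ⊆ Y →
        (S.D P.n).logvol j vQ X ≤ (S.D P.n).logvol j vQ Y)
    (hKumA : C.KummerA (S.D P.n))
    (hNE : ∀ n m : ℤ, Nonempty (P.IsoS (D.stripLGP (P.lattice.logLink n (m - 1)))
      (D.stripDelta (P.lattice.theater (n + 1) m))))
    (hfin : P.ThetaFinite) (hq : P.AbsLogQPos)
    (hgap : P.DisplayXIeReal → P.SheMeansFixedValueReal → A.GapGlobal) :
    Chain L (honestReading P C D L A) :=
  teamA_chain C D trivial trivial (PreX.linkGluing_nonempty P) trivial trivial trivial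
    (fun _ => trivial) (fun _ => ⟨trivial, trivial⟩) (fun _ => ⟨trivial, trivial, trivial⟩)
    (fun _ => ⟨trivial, trivial⟩) (fun _ => trivial) (fun _ _ => trivial)
    hIndAdm hIndVol hMono hKumA (fun h => h) (fun h => h) (fun h => h) (fun h => h)
    (VG := Nonempty (LinkGluing P)) (CIPL := L .IPL) (CSHE := L .SHE)
    (fun h => h) hNE (fun h => h) (fun h => h) (fun h => h) (fun h => h) (fun h => h) (fun h => h)
    (fun h => h) (fun h => h) (fun h => h)
    (agreesXIde_honestReading C D L A) hfin hq hgap A.out_qIn nthPower_not_formal trivial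

/-- **The (xi-f) slot of the honest reading IS the GapA of record**: since (xi-e)'s two honest outputs are theorems at
any setting with `ThetaFinite ∧ AbsLogQPos` (row A-3: `displayXIeReal_of_comparableObjectsReal`,
`sheMeansFixedValueReal_holds`), the implication `hgap` is equivalent to `A.GapGlobal` outright — nothing is hidden in
the antecedents. [folklore] -/
theorem gapSlot_iff_gapGlobal (A : InputStrip.StripAlgorithm P) (hfin : P.ThetaFinite) (hq : P.AbsLogQPos) :
    (P.DisplayXIeReal → P.SheMeansFixedValueReal → A.GapGlobal) ↔ A.GapGlobal :=
  ⟨fun h => h (P.displayXIeReal_of_comparableObjectsReal (P.comparableObjectsReal_iff.mpr ⟨hfin, hq⟩))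
      P.sheMeansFixedValueReal_holds,
    fun h _ _ => h⟩

/-- **TEAM A END-TO-END UNDER THE HONEST READING — eight hypotheses and THE GAP** ([IUTchIII] Cor. 3.12; the (G1)
vehicle «every inference other than (xi-f) is kernel-discharged over the frozen definitions» as ONE theorem):
granting the bridge hypotheses (c312-6), Team B's four Step (x) real discharges ((Ind1)(Ind2) admissibility transport,
log-volume invariance, monotonicity, the Kummer-(a) clause), the strip-isomorphism nonemptiness (L6-t2), `|log(q)| > 0`,
the loci (the frozen definitions / FACT-LIST facts in force: `∀ c, L c`) and the GapA of record `A.GapGlobal` —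
the printed `Statement` follows, with all thirty-six observations of the proof read honestly and all twenty nodes
verified in the kernel. Closing edge: skel XXV `InputStrip.StripAlgorithm.statement_of_gapGlobal` through c312-7's
`realEdges_verbatim_iff`. [claim: Mochizuki2012, status: disputed] -/
theorem teamA_statement_honest (H : BridgeHyps P) (C : Column S.L) (D : ThetaLinkStrips P.LogLink P.Strip)
    {L : Locus → Prop} (hL : ∀ c, L c) (A : InputStrip.StripAlgorithm P)
    (hIndAdm : ∀ Φ ∈ S.L.Ind1Family ∪ S.L.Ind2Family, ∀ (j : T.Label) (vQ : T.VQ)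
      (X : Set (S.L.Packet j vQ)), (S.D P.n).Adm j vQ X ↔ (S.D P.n).Adm j vQ (Φ j vQ '' X))
    (hIndVol : (S.D P.n).LogvolInvariant)
    (hMono : ∀ (j : T.Label) (vQ : T.VQ) (X Y : Set (S.L.Packet j vQ)),
      (S.D P.n).Adm j vQ X → (S.D P.n).Adm j vQ Y → X ⊆ Y →
        (S.D P.n).logvol j vQ X ≤ (S.D P.n).logvol j vQ Y)
    (hKumA : C.KummerA (S.D P.n))
    (hNE : ∀ n m : ℤ, Nonempty (P.IsoS (D.stripLGP (P.lattice.logLink n (m - 1)))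
      (D.stripDelta (P.lattice.theater (n + 1) m))))
    (hq : P.AbsLogQPos) (hgap : A.GapGlobal) :
    P.Statement :=
  (verbatimVolumes_cor312_iff H hq).1
    (cor312_of_chain hL
      (honest_chain C D L A hIndAdm hIndVol hMono hKumA hNE H.finite hq fun _ _ => hgap)
      ((realEdges_verbatim_iff H hq (honestReading P C D L A)).2 fun hc => A.statement_of_gapGlobal H hc))

/-- The same with the (xi-f) slot kept in its printed implication shape (between the TYPED (xi-e) outputs and the
GapA of record) — for a hypothesis census that wants to display the inference rather than its equivalent `A.GapGlobal`.
[claim: Mochizuki2012, status: disputed] -/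
theorem teamA_statement_honest_of_slot (H : BridgeHyps P) (C : Column S.L)
    (D : ThetaLinkStrips P.LogLink P.Strip) {L : Locus → Prop} (hL : ∀ c, L c) (A : InputStrip.StripAlgorithm P)
    (hIndAdm : ∀ Φ ∈ S.L.Ind1Family ∪ S.L.Ind2Family, ∀ (j : T.Label) (vQ : T.VQ)
      (X : Set (S.L.Packet j vQ)), (S.D P.n).Adm j vQ X ↔ (S.D P.n).Adm j vQ (Φ j vQ '' X))
    (hIndVol : (S.D P.n).LogvolInvariant)
    (hMono : ∀ (j : T.Label) (vQ : T.VQ) (X Y : Set (S.L.Packet j vQ)),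
      (S.D P.n).Adm j vQ X → (S.D P.n).Adm j vQ Y → X ⊆ Y →
        (S.D P.n).logvol j vQ X ≤ (S.D P.n).logvol j vQ Y)
    (hKumA : C.KummerA (S.D P.n))
    (hNE : ∀ n m : ℤ, Nonempty (P.IsoS (D.stripLGP (P.lattice.logLink n (m - 1)))
      (D.stripDelta (P.lattice.theater (n + 1) m))))
    (hq : P.AbsLogQPos)
    (hgap : P.DisplayXIeReal → P.SheMeansFixedValueReal → A.GapGlobal) :
    P.Statement :=
  teamA_statement_honest H C D hL A hIndAdm hIndVol hMono hKumA hNE hq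
    ((gapSlot_iff_gapGlobal A H.finite hq).mp hgap)


/-! ## From the typed Theorem 3.11: the Kummer-(a) input by name -/

section FromThm311

variable {S' : LatticeSituation T} {Q : Cor312.Setting S'.toSituation}

/-- **TEAM A END-TO-END from typed Theorem 3.11 (ii)** ([IUTchIII] Thm. 3.11 (ii) (a) p. 155 → Cor. 3.12): over a
lattice situation `S'` (c312-1), take the column `C := S'.col Q.n` of the setting's own vertical line; then the
Kummer-(a) input `hKumA` of the honest census IS the first conjunct of typed Thm 3.11 (ii) at column `n`
(`(hii Q.n).1`, as on Team B's route `Cor312LogKummerRoute2.statement_of_partII`). Census: {BridgeHyps, typed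
Thm 3.11 (ii), (Ind1)(Ind2) admissibility transport, log-volume invariance, monotone log-volume, strip-isomorphism
nonemptiness, `|log(q)| > 0`, loci, THE GAP `A.GapGlobal`} ⊢ `Statement`. [claim: Mochizuki2012, status: disputed] -/
theorem teamA_statement_honest_of_partII (H : BridgeHyps Q) (hii : S'.PartII)
    (D : ThetaLinkStrips Q.LogLink Q.Strip) {L : Locus → Prop} (hL : ∀ c, L c) (A : InputStrip.StripAlgorithm Q)
    (hIndAdm : ∀ Φ ∈ S'.L.Ind1Family ∪ S'.L.Ind2Family, ∀ (j : T.Label) (vQ : T.VQ)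
      (X : Set (S'.L.Packet j vQ)), (S'.D Q.n).Adm j vQ X ↔ (S'.D Q.n).Adm j vQ (Φ j vQ '' X))
    (hIndVol : (S'.D Q.n).LogvolInvariant)
    (hMono : ∀ (j : T.Label) (vQ : T.VQ) (X Y : Set (S'.L.Packet j vQ)),
      (S'.D Q.n).Adm j vQ X → (S'.D Q.n).Adm j vQ Y → X ⊆ Y →
        (S'.D Q.n).logvol j vQ X ≤ (S'.D Q.n).logvol j vQ Y)
    (hNE : ∀ n m : ℤ, Nonempty (Q.IsoS (D.stripLGP (Q.lattice.logLink n (m - 1)))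
      (D.stripDelta (Q.lattice.theater (n + 1) m))))
    (hq : Q.AbsLogQPos) (hgap : A.GapGlobal) :
    Q.Statement :=
  teamA_statement_honest H (S'.col Q.n) D hL A hIndAdm hIndVol hMono (hii Q.n).1 hNE hq hgap

end FromThm311

section FromThm311Full

variable {F : FullSituation T} {Q : Cor312.Setting F.toSituation}

/-- **TEAM A END-TO-END from the WHOLE typed Theorem 3.11** (c312-1's `FullSituation.Statement` = (i) ∧ (ii) ∧ (iii);
plan/ADJUDICATION-SPEC §2 shape «(h311 : F.Statement) … (GapA) ⊢ P.Statement»): of the typed Theorem 3.11 exactly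
the (ii) (a) clause at column `n` is CONSUMED (as on the log-Kummer route); census otherwise as in
`teamA_statement_honest_of_partII`. [claim: Mochizuki2012, status: disputed] -/
theorem teamA_statement_honest_of_thm311 (H : BridgeHyps Q) (h311 : F.Statement)
    (D : ThetaLinkStrips Q.LogLink Q.Strip) {L : Locus → Prop} (hL : ∀ c, L c) (A : InputStrip.StripAlgorithm Q)
    (hIndAdm : ∀ Φ ∈ F.L.Ind1Family ∪ F.L.Ind2Family, ∀ (j : T.Label) (vQ : T.VQ)
      (X : Set (F.L.Packet j vQ)), (F.D Q.n).Adm j vQ X ↔ (F.D Q.n).Adm j vQ (Φ j vQ '' X))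
    (hIndVol : (F.D Q.n).LogvolInvariant)
    (hMono : ∀ (j : T.Label) (vQ : T.VQ) (X Y : Set (F.L.Packet j vQ)),
      (F.D Q.n).Adm j vQ X → (F.D Q.n).Adm j vQ Y → X ⊆ Y →
        (F.D Q.n).logvol j vQ X ≤ (F.D Q.n).logvol j vQ Y)
    (hNE : ∀ n m : ℤ, Nonempty (Q.IsoS (D.stripLGP (Q.lattice.logLink n (m - 1)))
      (D.stripDelta (Q.lattice.theater (n + 1) m))))
    (hq : Q.AbsLogQPos) (hgap : A.GapGlobal) :
    Q.Statement :=
  teamA_statement_honest_of_partII (S' := F.toLatticeSituation) H h311.2.1 D hL A hIndAdm hIndVol hMono hNE hq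
    hgap

end FromThm311Full


/-- **The strip-isomorphism slot is always fillable at the frozen interface** (no-inflation remark, same status as
`PreX.linkGluing_nonempty`): the `ThetaLinkStrips` bookkeeping is DATA WE CHOOSE, and the setting's own signature
(L6-t4 `GlobalLGPFrobenioidSignature`: the strips `†𝔉^⊩_LGP`, `†𝔉^⊩_lgp` with the tautological isomorphism
`isoLGPlgp`, [IUTchIII] Prop. 3.7 (iv)) supplies a position-independent choice at which `hNE` holds. So `hNE` constrains
nothing over the frozen `Cor312.Setting`; its CONTENT (all `𝓕^{⊩▶×μ}`-prime-strips of the lattice are isomorphic,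
Def. 3.8 (ii)'s presupposition) lives at L6-t2's real strip categories, as the census says. [folklore] -/
theorem hNE_satisfiable (P : Cor312.Setting S) :
    ∃ D : ThetaLinkStrips P.LogLink P.Strip,
      ∀ n m : ℤ, Nonempty (P.IsoS (D.stripLGP (P.lattice.logLink n (m - 1)))
        (D.stripDelta (P.lattice.theater (n + 1) m))) :=
  ⟨⟨fun _ => P.sig.FLGP, fun _ => P.sig.FLGP, fun _ => P.sig.Flgp⟩, fun _ _ => ⟨P.sig.isoLGPlgp⟩⟩


/-! ## (G3) for THIS census: the eight non-gap hypotheses do not imply the gap -/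

/-- Log-volume invariance under the (Ind1)/(Ind2) families at Team A's gap witness: its two-valued log-volume
(`−2` on subsets of `{0}`, `−1` elsewhere) is invariant under every `ℚ`-linear automorphism of the packets, in
particular under both families. [folklore] -/
theorem gapData_logvolInvariant : GapWitness.gapData.LogvolInvariant := by
  intro Φ _ j vQ A _
  show GapWitness.gapVol j vQ (Φ j vQ '' A) = GapWitness.gapVol j vQ A
  have key : (⇑(Φ j vQ) '' A ⊆ ({0} : Set _)) ↔ A ⊆ ({0} : Set _) := by
    constructor
    · intro h x hx
      have hx0 : Φ j vQ x ∈ ({0} : Set _) := h ⟨x, hx, rfl⟩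
      rw [Set.mem_singleton_iff] at hx0 ⊢
      exact (Φ j vQ).injective (by rw [hx0, map_zero])
    · rintro h _ ⟨x, hx, rfl⟩
      rw [Set.mem_singleton_iff, Set.mem_singleton_iff.mp (h hx), map_zero]
  by_cases hA : A ⊆ ({0} : Set _)
  · rw [GapWitness.gapVol_of_subset hA, GapWitness.gapVol_of_subset (key.mpr hA)]
  · rw [GapWitness.gapVol_of_not_subset hA, GapWitness.gapVol_of_not_subset (mt key.mp hA)]

/-- **(G3) transferred to the honest census's EXACT hypothesis list**: there is an instantiation (Team A's gap witness,
`GapWitness.gapSetting` over `gapFull`) at which the typed Theorem 3.11 holds IN FULL, the bridge hypotheses hold,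
(Ind1)(Ind2) admissibility transport, log-volume invariance and monotonicity hold, the Kummer-(a) clause of the
setting's own column holds, the strip-isomorphism slot is filled, `|log(q)| > 0`, a strip-algorithm presentation
exists — and `GapGlobal` FAILS for EVERY strip algorithm. So the eight non-gap hypotheses of
`teamA_statement_honest_of_thm311` are jointly satisfiable with the NEGATION of the gap: the honest census is
non-circular bookkeeping around ONE non-derivable inference (interface level; STRONG-DEGENERATE class — the same one-place
two-valued engine as `GapWitness.thm311_bridgeHyps_not_imp_statement`, cf. ref-b B11-4). [claim: Mochizuki2012, status: disputed] -/
theorem honestCensus_premises_not_imp_gap :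
    ∃ (T : ThetaIndex) (F : FullSituation T) (Q : Cor312.Setting F.toSituation)
      (D : ThetaLinkStrips Q.LogLink Q.Strip),
      F.Statement ∧ BridgeHyps Q ∧
      (∀ Φ ∈ F.L.Ind1Family ∪ F.L.Ind2Family, ∀ (j : T.Label) (vQ : T.VQ) (X : Set (F.L.Packet j vQ)),
        (F.D Q.n).Adm j vQ X ↔ (F.D Q.n).Adm j vQ (Φ j vQ '' X)) ∧
      (F.D Q.n).LogvolInvariant ∧
      (∀ (j : T.Label) (vQ : T.VQ) (X Y : Set (F.L.Packet j vQ)),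
        (F.D Q.n).Adm j vQ X → (F.D Q.n).Adm j vQ Y → X ⊆ Y → (F.D Q.n).logvol j vQ X ≤ (F.D Q.n).logvol j vQ Y) ∧
      (F.col Q.n).KummerA (F.D Q.n) ∧
      (∀ n m : ℤ, Nonempty (Q.IsoS (D.stripLGP (Q.lattice.logLink n (m - 1)))
        (D.stripDelta (Q.lattice.theater (n + 1) m)))) ∧
      Q.AbsLogQPos ∧ Nonempty (InputStrip.StripAlgorithm Q) ∧
      ∀ A : InputStrip.StripAlgorithm Q, ¬ A.GapGlobal :=
  ⟨Cor312.Checks.toyIndex, GapWitness.gapFull, GapWitness.gapSetting,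
    ⟨fun _ => (), fun _ => (), fun _ => ()⟩,
    GapWitness.gapFull_statement, GapWitness.gapSetting_bridgeHyps,
    fun _ _ _ _ _ => Iff.rfl, gapData_logvolInvariant,
    fun _ _ _ _ _ _ h => GapWitness.gapData_logvol_mono h,
    (GapWitness.gap_partII _).1, fun _ _ => ⟨()⟩, GapWitness.gapSetting_absLogQPos,
    ⟨InputStrip.StripAlgorithm.canonical _⟩, InputStrip.not_gapGlobal_gapSetting⟩

/-- **Non-vacuity of the data slots**: every setting carries a strip-algorithm presentation (`StripAlgorithm.canonical`)
and a value-group gluing (`PreX.linkGluing_nonempty`), so the honest reading is available for EVERY frozen setting —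
the census above is not conditional on extra structure. [folklore] -/
theorem honestReading_available (C : Column S.L) (D : ThetaLinkStrips P.LogLink P.Strip) (L : Locus → Prop) :
    ∃ O : Obs → Prop, ∃ A : InputStrip.StripAlgorithm P, O = honestReading P C D L A :=
  ⟨_, InputStrip.StripAlgorithm.canonical P, rfl⟩

end Cor312Proof

end IUTFork

end Summit.ABC
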